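import Literature.Analysis.FluidPDE.NSBoundedMildOseenDuhamel
import Literature.Analysis.FluidPDE.KochTataruIntegralOfClass
import Literature.Analysis.UnboundedOperators.HeatKernelBoundedData
import Literature.Analysis.UnboundedOperators.HeatSemigroupLpProofs
import Literature.Analysis.FunctionSpaces.LittlewoodPaleyBernsteinProofs
import HarnessLib

/-!
# Bounded Besov mild solutions solve the Oseen integral equation — discharge of (A)

Analysis/FluidPDE proofs file for the decomposition `NSBoundedMildOseen.lean` of the smoothing
fact `Literature.Analysis.FluidPDE.knss_classical_of_bounded_isBesovMildSolutionOn`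
(Koch–Nadirashvili–Seregin–Šverák 2009, §4). It **discharges the named fact (A)**
`Literature.Analysis.FluidPDE.oseenMild_of_bounded_isBesovMildSolutionOn`
(`oseenMild_of_bounded_isBesovMildSolutionOn_holds`): a Besov mild solution `(u, U)` on `[0, T)`
(duality form from the datum `u 0`, `U ∈ C([0,T); Ḃ^{-1+3/p}_{p,q})`, `3 < p < ∞`, `1 ≤ q < ∞`)
whose slices are uniformly essentially bounded on every `(0, T₁)`, `T₁ < T`, satisfies the Oseen
integral equation `u(t) = e^{νtΔ}u(0) - B^ν_0(u,u)(t)` a.e., for every `t ∈ (0, T)`.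

The sibling `NSBoundedMildOseenDuhamel.lean` proves (A1)
`exists_const_oseenMild_of_bounded_isBesovMildSolutionOn`: the identity holds up to an additive
constant vector `c = c(t)` (annihilator lemma in `L^∞`; KNSS 2009, Lemma 3.1 / Rem. 3.1, the drift
`b(t)`). This file proves `c = 0`, which is where the Besov hypothesis enters, following the
printed mechanism of Lemarié-Rieusset 2016, Lemma 6.4 (B) ⇒ Prop. 6.5 ⇒ Thm. 6.1: the harmonic
remainder *vanishes at infinity*, `e^{τΔ}Q → 0` in `𝓢'` as `τ → ∞` (Def. 6.4–6.5, uniqueness of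
the Leray projection, PDF p. 130), hence is zero.

1. **Vanishing at infinity of Besov slices** (`§ Vanishing`):
   `tendsto_heatSemigroup_apply_atTop_of_memHomBesov` — for `U ∈ Ḃ^s_{p,q}` with `s < 0`,
   `⟨e^{τΔ}U, θ⟩ → 0` as `τ → ∞` for every Schwartz `θ` (`‖e^{τΔ}U‖_{L^p} ≤ C τ^{s/2}‖U‖_{Ḃ^s_{p,∞}}`,
   `exists_eLpNormDistrib_heatSemigroup_le_rpow_mul_eHomBesovNorm`, BCD Thm. 2.34, and Hölder for
   the pairing); the realisation clause `Ṡ_j U → 0` of `MemHomBesov` is used there.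
2. **The heat transpose on bounded fields** (`§ Transpose`): with
   `T_a θ = 𝓕(e^{-(2π)²a|ξ|²} 𝓕⁻¹θ) = G_a ∗ θ` the transpose of `e^{aΔ}` on `𝓢'`
   (`⟨e^{aΔ}W, θ⟩ = ⟨W, T_a θ⟩`, `heatSemigroup_apply_apply`), for every bounded measurable field
   `f` and `a > 0`, `∫ θ • e^{aΔ}f = ∫ (T_a θ) • f` (`integral_smul_complexify_heatExtension_eq`;
   Fubini, the Gauss–Weierstrass kernel being even).
3. **The Duhamel term of a bounded field vanishes at infinity** (`§ PathNorm`, `§ Rescale`,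
   `§ HeatDecay`): a bounded strongly measurable field `u`, truncated to `(0, t)` and rescaled in
   time, `ũ = 1_{(0,νt)}(s) u(s/ν)`, lies in Koch–Tataru's path space and
   `B(ũ, ũ)(νt) = ν • B^ν_0(u,u)(t)` (`kochTataruBilinear_rescale_eq_smul_oseenDuhamel`, the change
   of variables `s = ντ`), so that the decay `‖e^{τΔ}B(ũ,ũ)(νt)‖_∞ ≤ C τ^{-1/2}‖ũ‖_X²` of
   `KochTataruIntegralOfClass.lean` (Fubini and the kernel semigroup law `e^{τΔ}K(σ) = K(σ + τ)`)
   gives `‖e^{τΔ}B^ν_0(u,u)(t)‖_∞ ≤ C' τ^{-1/2}` (`exists_norm_heatExtension_oseenDuhamel_le`).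
4. **The assembly** (`§ Assembly`): with `c` from (A1) and the Gaussian `θ`, testing
   `e^{νtΔ}u(0) - B^ν_0(u,u)(t) - u(t) = c` against `T_τ θ` gives
   `(∫ θ) c = ⟨e^{(τ+νt)Δ}U(0), θ⟩ - ∫ θ • e^{τΔ}B - ⟨e^{τΔ}U(t), θ⟩ → 0`, so `c = 0`. The
   Duhamel term and the free term only see a.e. classes, and are computed on bounded strongly
   measurable representatives (`exists_stronglyMeasurable_representative`).

## References

* P. G. Lemarié-Rieusset, *The Navier–Stokes problem in the 21st century*, CRC Press 2016 (held),
  Def. 6.4–6.5 (PDF pp. 129–132), Lemma 6.4 (B) (p. 133), Thm. 6.1 (p. 135), Prop. 6.5 (p. 136).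
  [LemarieRieusset2016]
* G. Koch, N. Nadirashvili, G. Seregin, V. Šverák, Acta Math. 203 (2009) = arXiv:0709.3599, §3
  Lemma 3.1 / Rem. 3.1 (p. 7), §4 (i) (p. 8). [KochNadirashviliSereginSverak2009]
* H. Bahouri, J.-Y. Chemin, R. Danchin, *Fourier Analysis and Nonlinear PDE* (2011), Def. 1.26,
  Thm. 2.34. [BahouriCheminDanchin2011]
* H. Koch, D. Tataru, Adv. Math. 157 (2001), §1 (3), §3 (11)–(14). [KochTataruAdvMath2001]
-/

noncomputable section

open MeasureTheory Set Function Filter Metric TopologicalSpace InnerProductSpace SchwartzMap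
open _root_.Topology _root_.Real
open scoped ENNReal NNReal RealInnerProductSpace SchwartzMap FourierTransform Pointwise

namespace Literature.Analysis.FluidPDE

open UnboundedOperators (heatKernel heatExtension heatSymbol)
open FunctionSpaces (MemHomBesov eHomBesovNorm eLpNormDistrib)
open FunctionSpaces.EuclideanSpace (complexify)

/-! ## Bounded fields with bounded time support have finite Koch–Tataru norm -/

section PathNorm

variable {E : Type*} [NormedAddCommGroup E] [InnerProductSpace ℝ E] [FiniteDimensional ℝ E]
  [MeasurableSpace E] [BorelSpace E]

/-- **A bounded field supported in a bounded time interval lies in Koch–Tataru's path space**: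
if `‖w(s, y)‖ ≤ M` everywhere and `w(s) = 0` for `s ≥ S` (`0 ≤ M`; for `S ≤ 0` the field vanishes
at all positive times), then `‖w‖_X ≤ √S M + (M² S |B₁|)^{1/2} < ∞` (`√s ‖w(s)‖_∞ ≤ √S M`, and
every Carleson box has `R^{-d} ∫₀^{R²}∫_{B(x,R)} |w|² ≤ M² |B₁| min(R², S) ≤ M² |B₁| S`;
Koch–Tataru 2001, (3)). [cite: KochTataruAdvMath2001, §1 (3)] -/
theorem eKochTataruNorm_lt_top_of_bound_of_eq_zero {w : ℝ → E → E} {M S : ℝ} (hM : 0 ≤ M)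
    (hb : ∀ s y, ‖w s y‖ ≤ M) (hz : ∀ s, S ≤ s → w s = 0) :
    eKochTataruNorm w < ∞ := by
  have hb' : ∀ s y, ‖w s y‖ₑ ≤ ENNReal.ofReal M := fun s y => by
    rw [← ofReal_norm]; exact ENNReal.ofReal_le_ofReal (hb s y)
  -- the sup part
  have hsup : (⨆ (s : ℝ) (_ : 0 < s), ENNReal.ofReal (Real.sqrt s) * eLpNorm (w s) ∞ volume) ≤
      ENNReal.ofReal (Real.sqrt S) * ENNReal.ofReal M := by
    refine iSup₂_le fun s hs => ?_
    rcases le_or_gt S s with hSs | hsS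
    · rw [hz s hSs]
      simp
    · have h1 : eLpNorm (w s) ∞ volume ≤ ENNReal.ofReal M := by
        rw [eLpNorm_exponent_top]
        exact eLpNormEssSup_le_of_ae_enorm_bound (Eventually.of_forall fun y => hb' s y)
      have h2 : ENNReal.ofReal (Real.sqrt s) ≤ ENNReal.ofReal (Real.sqrt S) :=
        ENNReal.ofReal_le_ofReal (Real.sqrt_le_sqrt hsS.le)
      exact mul_le_mul' h2 h1
  -- one Carleson box
  set V : ℝ≥0∞ := volume (ball (0 : E) 1) with hV
  have hVtop : V < ∞ := measure_ball_lt_top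
  have hbox : ∀ (x : E) (R : ℝ), 0 < R →
      (ENNReal.ofReal (R ^ Module.finrank ℝ E))⁻¹ *
        ∫⁻ s in Ioo 0 (R ^ 2), ∫⁻ y in ball x R, ‖w s y‖ₑ ^ 2 ≤
        ENNReal.ofReal (M ^ 2 * S) * V := by
    intro x R hR
    have hRd : 0 < R ^ Module.finrank ℝ E := pow_pos hR _
    -- the inner integral on a slice
    have hinner : ∀ s, ∫⁻ y in ball x R, ‖w s y‖ₑ ^ 2 ≤
        (Iio S).indicator (fun _ => ENNReal.ofReal (M ^ 2) * volume (ball x R)) s := by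
      intro s
      rcases le_or_gt S s with hSs | hsS
      · rw [hz s hSs, indicator_of_notMem (by simpa using hSs)]
        simp
      · rw [indicator_of_mem (by simpa using hsS)]
        calc ∫⁻ y in ball x R, ‖w s y‖ₑ ^ 2 ≤ ∫⁻ y in ball x R, ENNReal.ofReal (M ^ 2) := by
              refine lintegral_mono fun y => ?_
              calc ‖w s y‖ₑ ^ 2 ≤ (ENNReal.ofReal M) ^ 2 := by gcongr; exact hb' s y
                _ = ENNReal.ofReal (M ^ 2) := by rw [ENNReal.ofReal_pow hM]
          _ = ENNReal.ofReal (M ^ 2) * volume (ball x R) := by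
              rw [lintegral_const, Measure.restrict_apply MeasurableSet.univ, univ_inter]
    have hball : volume (ball x R) = ENNReal.ofReal (R ^ Module.finrank ℝ E) * V := by
      rw [hV]
      exact Measure.addHaar_ball_of_pos volume x hR
    calc (ENNReal.ofReal (R ^ Module.finrank ℝ E))⁻¹ *
          ∫⁻ s in Ioo 0 (R ^ 2), ∫⁻ y in ball x R, ‖w s y‖ₑ ^ 2
        ≤ (ENNReal.ofReal (R ^ Module.finrank ℝ E))⁻¹ *
          ∫⁻ s in Ioo 0 (R ^ 2), (Iio S).indicator (fun _ => ENNReal.ofReal (M ^ 2) * volume (ball x R)) s := by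
          gcongr with s
          exact hinner s
      _ = (ENNReal.ofReal (R ^ Module.finrank ℝ E))⁻¹ *
          (ENNReal.ofReal (M ^ 2) * volume (ball x R) * volume (Ioo 0 (R ^ 2) ∩ Iio S)) := by
          rw [lintegral_indicator measurableSet_Iio, setLIntegral_const, Measure.restrict_apply measurableSet_Iio,
            inter_comm]
      _ ≤ (ENNReal.ofReal (R ^ Module.finrank ℝ E))⁻¹ *
          (ENNReal.ofReal (M ^ 2) * volume (ball x R) * ENNReal.ofReal S) := by
          gcongr
          calc volume (Ioo 0 (R ^ 2) ∩ Iio S) ≤ volume (Ioo 0 S) := by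
                refine measure_mono fun s hs => ⟨hs.1.1, hs.2⟩
            _ = ENNReal.ofReal S := by rw [Real.volume_Ioo, sub_zero]
      _ = ENNReal.ofReal (M ^ 2 * S) * V := by
          rw [hball, ENNReal.ofReal_mul (sq_nonneg M)]
          have hne0 : ENNReal.ofReal (R ^ Module.finrank ℝ E) ≠ 0 := (ENNReal.ofReal_pos.2 hRd).ne'
          calc (ENNReal.ofReal (R ^ Module.finrank ℝ E))⁻¹ *
                (ENNReal.ofReal (M ^ 2) * (ENNReal.ofReal (R ^ Module.finrank ℝ E) * V) * ENNReal.ofReal S)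
              = ((ENNReal.ofReal (R ^ Module.finrank ℝ E))⁻¹ * ENNReal.ofReal (R ^ Module.finrank ℝ E)) *
                  (ENNReal.ofReal (M ^ 2) * ENNReal.ofReal S * V) := by ring
            _ = ENNReal.ofReal (M ^ 2) * ENNReal.ofReal S * V := by
                rw [ENNReal.inv_mul_cancel hne0 ENNReal.ofReal_ne_top, one_mul]
  have hcar : (⨆ (x : E) (R : ℝ) (_ : 0 < R),
      ((ENNReal.ofReal (R ^ Module.finrank ℝ E))⁻¹ *
        ∫⁻ s in Ioo 0 (R ^ 2), ∫⁻ y in ball x R, ‖w s y‖ₑ ^ 2) ^ (1 / 2 : ℝ)) ≤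
      (ENNReal.ofReal (M ^ 2 * S) * V) ^ (1 / 2 : ℝ) := by
    refine iSup_le fun x => iSup₂_le fun R hR => ?_
    exact ENNReal.rpow_le_rpow (hbox x R hR) (by norm_num)
  calc eKochTataruNorm w
      ≤ ENNReal.ofReal (Real.sqrt S) * ENNReal.ofReal M + (ENNReal.ofReal (M ^ 2 * S) * V) ^ (1 / 2 : ℝ) :=
        add_le_add hsup hcar
    _ < ∞ := by
        refine ENNReal.add_lt_top.2 ⟨ENNReal.mul_lt_top ENNReal.ofReal_lt_top ENNReal.ofReal_lt_top, ?_⟩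
        exact ENNReal.rpow_lt_top_of_nonneg (by norm_num)
          (ENNReal.mul_lt_top ENNReal.ofReal_lt_top hVtop).ne

end PathNorm

/-! ## The truncated, time-rescaled field and the change of variables `s = ντ` -/

section Rescale

variable {E : Type*} [NormedAddCommGroup E] [InnerProductSpace ℝ E] [FiniteDimensional ℝ E]
  [MeasurableSpace E] [BorelSpace E] {u : ℝ → E → E} {M ν t : ℝ}

omit [InnerProductSpace ℝ E] [FiniteDimensional ℝ E] [BorelSpace E] in
/-- The truncated time-rescaled field `ũ = 1_{(0,νt)}(s) u(s/ν)` is jointly strongly measurable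
when `u` is. [folklore] -/
theorem stronglyMeasurable_uncurry_indicator_rescale (hu : StronglyMeasurable (uncurry u)) (ν t : ℝ) :
    StronglyMeasurable (uncurry ((Ioo 0 (ν * t)).indicator fun s => u (s / ν))) := by
  have heq : uncurry ((Ioo 0 (ν * t)).indicator fun s => u (s / ν)) =
      (Ioo 0 (ν * t) ×ˢ (univ : Set E)).indicator fun p : ℝ × E => uncurry u (p.1 / ν, p.2) := by
    funext p
    rcases p with ⟨s, y⟩
    by_cases hs : s ∈ Ioo 0 (ν * t)
    · rw [uncurry_apply_pair, indicator_of_mem hs, indicator_of_mem (mk_mem_prod hs (mem_univ y))]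
      rfl
    · rw [uncurry_apply_pair, indicator_of_notMem hs,
        indicator_of_notMem (fun h => hs (mem_prod.1 h).1)]
      rfl
  rw [heq]
  refine StronglyMeasurable.indicator ?_ (measurableSet_Ioo.prod MeasurableSet.univ)
  exact hu.comp_measurable ((measurable_fst.div_const ν).prodMk measurable_snd)

omit [InnerProductSpace ℝ E] [FiniteDimensional ℝ E] [MeasurableSpace E] [BorelSpace E] in
/-- The truncated time-rescaled field inherits the pointwise bound `‖ũ‖ ≤ M` (`0 ≤ M`). [folklore] -/
theorem norm_indicator_rescale_le (hM : 0 ≤ M) (hb : ∀ s y, ‖u s y‖ ≤ M) (ν t s : ℝ) (y : E) :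
    ‖(Ioo 0 (ν * t)).indicator (fun s => u (s / ν)) s y‖ ≤ M := by
  by_cases hs : s ∈ Ioo 0 (ν * t)
  · rw [indicator_of_mem hs]; exact hb _ _
  · rw [indicator_of_notMem hs]; simpa using hM

omit [InnerProductSpace ℝ E] [FiniteDimensional ℝ E] [MeasurableSpace E] [BorelSpace E] in
/-- The truncated time-rescaled field vanishes for `s ≥ νt`. [folklore] -/
theorem indicator_rescale_eq_zero_of_le {s : ℝ} (hs : ν * t ≤ s) :
    (Ioo 0 (ν * t)).indicator (fun s => u (s / ν)) s = 0 :=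
  indicator_of_notMem (fun h => not_lt.2 hs h.2) _

omit [InnerProductSpace ℝ E] [FiniteDimensional ℝ E] [MeasurableSpace E] [BorelSpace E] in
/-- The slices of the truncated time-rescaled field: `ũ(ντ) = u(τ)` for `τ ∈ (0, t)` (`ν > 0`). [folklore] -/
theorem indicator_rescale_apply_mul (hν : 0 < ν) {τ : ℝ} (hτ : τ ∈ Ioo 0 t) :
    (Ioo 0 (ν * t)).indicator (fun s => u (s / ν)) (ν * τ) = u τ := by
  have hmem : ν * τ ∈ Ioo 0 (ν * t) := ⟨mul_pos hν hτ.1, mul_lt_mul_of_pos_left hτ.2 hν⟩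
  rw [indicator_of_mem hmem]
  simp only [mul_div_cancel_left₀ τ hν.ne']

/-- The truncated time-rescaled field of a bounded field has finite Koch–Tataru norm
(`eKochTataruNorm_lt_top_of_bound_of_eq_zero` with `S = νt`). [cite: KochTataruAdvMath2001, §1 (3)] -/
theorem eKochTataruNorm_indicator_rescale_lt_top (hM : 0 ≤ M) (hb : ∀ s y, ‖u s y‖ ≤ M) (ν t : ℝ) :
    eKochTataruNorm ((Ioo 0 (ν * t)).indicator fun s => u (s / ν)) < ∞ :=
  eKochTataruNorm_lt_top_of_bound_of_eq_zero hM
    (fun s y => norm_indicator_rescale_le hM hb ν t s y) fun _ hs => indicator_rescale_eq_zero_of_le hs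

omit [InnerProductSpace ℝ E] [FiniteDimensional ℝ E] [MeasurableSpace E] [BorelSpace E] in
/-- **Change of variables in time for integrals over `(0, νt)`**: `∫_{(0,νt)} g(s) ds = ν ∫_{(0,t)} g(ντ) dτ`
(`ν > 0`; valid for the Bochner integral without integrability assumptions). [folklore] -/
theorem setIntegral_Ioo_mul_eq_smul {F : Type*} [NormedAddCommGroup F] [NormedSpace ℝ F]
    (g : ℝ → F) (hν : 0 < ν) (t : ℝ) :
    ∫ s in Ioo 0 (ν * t), g s = ν • ∫ τ in Ioo 0 t, g (ν * τ) := by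
  have h := Measure.setIntegral_comp_smul_of_pos (μ := (volume : Measure ℝ)) g (Ioo 0 t) hν
  simp only [smul_eq_mul, Module.finrank_self, pow_one, LinearOrderedField.smul_Ioo hν, mul_zero] at h
  rw [h, ← mul_smul, mul_inv_cancel₀ hν.ne', one_smul]

/-- **The Duhamel term of the rescaled field** (KNSS 2009, §4 p. 8: the viscosity is a time
rescaling of `u = U + B(u,u)`): for `ν > 0` and any field `u`,
`B(ũ, ũ)(νt)(x) = ν • B^ν_0(u, u)(t)(x)` with `ũ = 1_{(0,νt)}(s) u(s/ν)` — substitute `s = ντ` in the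
time integral; `ũ(ντ) = u(τ)` on `(0, t)`. [cite: KochNadirashviliSereginSverak2009, §4 p. 8 (arXiv:0709.3599)] -/
theorem kochTataruBilinear_rescale_eq_smul_oseenDuhamel (hν : 0 < ν) (t : ℝ) (x : E) :
    kochTataruBilinear ((Ioo 0 (ν * t)).indicator fun s => u (s / ν))
        ((Ioo 0 (ν * t)).indicator fun s => u (s / ν)) (ν * t) x =
      ν • oseenDuhamel ν 0 u u t x := by
  set w : ℝ → E → E := (Ioo 0 (ν * t)).indicator fun s => u (s / ν) with hw
  rw [kochTataruBilinear, oseenDuhamel,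
    setIntegral_Ioo_mul_eq_smul (fun s => ∫ y, oseenKernel (ν * t - s) (x - y) (w s y) (w s y)) hν t]
  congr 1
  refine setIntegral_congr_fun measurableSet_Ioo fun τ hτ => ?_
  simp only [hw, indicator_rescale_apply_mul hν hτ, mul_sub]

end Rescale

/-! ## The Duhamel term of a bounded field vanishes at infinity under the heat flow -/

section HeatDecay

variable {E : Type*} [NormedAddCommGroup E] [InnerProductSpace ℝ E] [FiniteDimensional ℝ E]
  [MeasurableSpace E] [BorelSpace E] {u : ℝ → E → E} {M ν t : ℝ}

/-- **The Duhamel term of a bounded field vanishes at infinity** (Lemarié-Rieusset 2016, Def. 6.5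
and the proof of Lemma 6.4 (B): `lim_{τ→∞} e^{τΔ}Q = 0` for the Oseen right-hand side): for a
bounded, jointly strongly measurable field `u` and `ν, t > 0` there is `C` with
`‖(e^{τΔ}B^ν_0(u,u)(t))(x)‖ ≤ C τ^{-1/2}` for all `τ > 0`, `x ∈ E` — the decay estimate
`exists_norm_heatExtension_kochTataruBilinear_le` of `KochTataruIntegralOfClass.lean` for the
rescaled field `ũ` (`kochTataruBilinear_rescale_eq_smul_oseenDuhamel`,
`eKochTataruNorm_indicator_rescale_lt_top`). [cite: LemarieRieusset2016, Def. 6.5 and Lemma 6.4 (B)] -/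
theorem exists_norm_heatExtension_oseenDuhamel_le (hu : StronglyMeasurable (uncurry u)) (hM : 0 ≤ M)
    (hb : ∀ s y, ‖u s y‖ ≤ M) (hν : 0 < ν) (ht : 0 < t) :
    ∃ C : ℝ, ∀ ⦃τ : ℝ⦄, 0 < τ → ∀ x : E,
      ‖heatExtension (oseenDuhamel ν 0 u u t) τ x‖ ≤ C * τ ^ (-(1 / 2 : ℝ)) := by
  set w : ℝ → E → E := (Ioo 0 (ν * t)).indicator fun s => u (s / ν) with hw
  have hm := (stronglyMeasurable_uncurry_indicator_rescale hu ν t).aestronglyMeasurable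
    (μ := (volume : Measure (ℝ × E)).restrict (Ioi 0 ×ˢ univ))
  have hX := eKochTataruNorm_indicator_rescale_lt_top hM hb ν t
  have hνt : 0 < ν * t := mul_pos hν ht
  obtain ⟨C, -, hbound⟩ := exists_norm_heatExtension_kochTataruBilinear_le E
  rw [← hw] at hm hX
  refine ⟨ν⁻¹ * (C * (eKochTataruNorm w).toReal * (eKochTataruNorm w).toReal), fun τ hτ x => ?_⟩
  have heq : oseenDuhamel ν 0 u u t = fun x => ν⁻¹ • kochTataruBilinear w w (ν * t) x := by
    funext x
    rw [hw, kochTataruBilinear_rescale_eq_smul_oseenDuhamel hν t x, smul_smul, inv_mul_cancel₀ hν.ne',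
      one_smul]
  rw [heq, UnboundedOperators.heatExtension_const_smul, norm_smul, Real.norm_of_nonneg (inv_pos.2 hν).le]
  calc ν⁻¹ * ‖heatExtension (kochTataruBilinear w w (ν * t)) τ x‖
      ≤ ν⁻¹ * (C * τ ^ (-(1 / 2 : ℝ)) * (eKochTataruNorm w).toReal * (eKochTataruNorm w).toReal) := by
        gcongr
        exact hbound hm hm hX hX hνt hτ x
    _ = ν⁻¹ * (C * (eKochTataruNorm w).toReal * (eKochTataruNorm w).toReal) * τ ^ (-(1 / 2 : ℝ)) := by
        ring

end HeatDecay

/-! ## Besov slices vanish at infinity under the heat flow -/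

section Vanishing

variable {E : Type*} [NormedAddCommGroup E] [InnerProductSpace ℝ E] [FiniteDimensional ℝ E]
  [MeasurableSpace E] [BorelSpace E] {F : Type*} [NormedAddCommGroup F] [NormedSpace ℂ F]
  [CompleteSpace F]

/-- **Distributions of negative homogeneous Besov regularity vanish at infinity under the heat
flow** (Lemarié-Rieusset 2016, Def. 6.4–6.5: "`lim_{τ→+∞} e^{τΔ}F = 0` in `𝓢'`"; Bahouri–Chemin–
Danchin, Thm. 2.34, the heat characterisation of `Ḃ^{-σ}_{p,∞}`): if `U ∈ Ḃ^s_{p,q}` with `s < 0`,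
`1 ≤ p ≤ ∞`, `q ≠ 0` (finite norm and the realisation condition `Ṡ_j U → 0`), then
`⟨e^{τΔ}U, θ⟩ → 0` as `τ → ∞` for every Schwartz `θ`:
`‖⟨e^{τΔ}U, θ⟩‖ ≤ ‖θ‖_{L^{p'}} ‖e^{τΔ}U‖_{L^p} ≤ ‖θ‖_{L^{p'}} C τ^{s/2} ‖U‖_{Ḃ^s_{p,∞}}`
(`exists_eLpNormDistrib_heatSemigroup_le_rpow_mul_eHomBesovNorm`). [cite: LemarieRieusset2016, Def. 6.5; BahouriCheminDanchin2011 Thm. 2.34] -/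
theorem tendsto_heatSemigroup_apply_atTop_of_memHomBesov {s : ℝ} {p q : ℝ≥0∞} [hp : Fact (1 ≤ p)]
    (hs : s < 0) (hq : q ≠ 0) {U : 𝓢'(E, F)} (hU : MemHomBesov s p q U) (θ : 𝓢(E, ℂ)) :
    Tendsto (fun τ : ℝ => TemperedDistribution.heatSemigroup τ U θ) atTop (𝓝 0) := by
  haveI : p.HolderConjugate (1 - p⁻¹)⁻¹ := ENNReal.HolderConjugate.inv_one_sub_inv' hp.out
  obtain ⟨C, hC⟩ := FunctionSpaces.exists_eLpNormDistrib_heatSemigroup_le_rpow_mul_eHomBesovNorm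
    (E := E) (F := F) p (σ := -s) (by linarith)
  simp only [neg_neg] at hC
  -- the `q = ∞` norm is finite
  set N : ℝ≥0∞ := eHomBesovNorm s p ∞ U with hN
  have hNq : N ≤ eHomBesovNorm s p q U := eHomBesovNorm_exponent_antitone s p hq le_top U
  have hNtop : N < ∞ := hNq.trans_lt hU.1
  set A : ℝ := (eLpNorm (⇑θ) (1 - p⁻¹)⁻¹ (volume : Measure E)).toReal with hA
  -- the bound for `τ > 0`
  have hbd : ∀ τ : ℝ, 0 < τ → ‖TemperedDistribution.heatSemigroup τ U θ‖ ≤ A * (C * τ ^ (s / 2) * N.toReal) := by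
    intro τ hτ
    have hLp : eLpNormDistrib p (TemperedDistribution.heatSemigroup τ U) ≤
        C * ENNReal.ofReal (τ ^ (s / 2)) * N := hC τ hτ U hU.2
    have hLp_top : eLpNormDistrib p (TemperedDistribution.heatSemigroup τ U) < ⊤ :=
      hLp.trans_lt (ENNReal.mul_lt_top (ENNReal.mul_lt_top ENNReal.coe_lt_top ENNReal.ofReal_lt_top) hNtop)
    refine (FunctionSpaces.norm_apply_le_of_eLpNormDistrib_lt_top (q := (1 - p⁻¹)⁻¹) hLp_top θ).trans ?_
    rw [ENNReal.toReal_mul]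
    refine mul_le_mul_of_nonneg_left ?_ ENNReal.toReal_nonneg
    have h := ENNReal.toReal_mono (ENNReal.mul_ne_top (ENNReal.mul_ne_top ENNReal.coe_ne_top
      ENNReal.ofReal_ne_top) hNtop.ne) hLp
    rwa [ENNReal.toReal_mul, ENNReal.toReal_mul, ENNReal.coe_toReal,
      ENNReal.toReal_ofReal (Real.rpow_nonneg hτ.le _)] at h
  -- `τ^{s/2} → 0`
  have hlim : Tendsto (fun τ : ℝ => A * (C * τ ^ (s / 2) * N.toReal)) atTop (𝓝 0) := by
    have h0 : Tendsto (fun τ : ℝ => τ ^ (s / 2)) atTop (𝓝 0) := by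
      have := tendsto_rpow_neg_atTop (y := -(s / 2)) (by linarith)
      simpa using this
    have := ((h0.const_mul (C : ℝ)).mul_const N.toReal).const_mul A
    simpa using this
  refine squeeze_zero_norm' ?_ hlim
  filter_upwards [eventually_gt_atTop 0] with τ hτ
  exact hbd τ hτ

end Vanishing

/-! ## The heat transpose `T_a θ = G_a ∗ θ` on Schwartz functions, against bounded fields -/

section Transpose

variable {ι : Type*} [Fintype ι] {E : Type*} [NormedAddCommGroup E] [InnerProductSpace ℝ E]
  [FiniteDimensional ℝ E] [MeasurableSpace E] [BorelSpace E]

omit [Fintype ι] in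
/-- **The heat transpose is convolution with the Gauss–Weierstrass kernel**: for `a > 0` and a
Schwartz `θ`, `T_a θ (y) = 𝓕(e^{-(2π)²a|·|²} 𝓕⁻¹θ)(y) = ∫ θ(x) G_a(y - x) dx`
(`fourier_smulLeftCLM_fourierInv_apply_eq_integral` with the Gaussian Schwartz symbol of
`exists_schwartzMap_coe_eq_heatSymbol`, whose Fourier transform is the even kernel `G_a`;
Stein–Weiss, Ch. I, Thm. 1.13). [folklore] -/
theorem fourier_smulLeftCLM_heatSymbol_fourierInv_apply {a : ℝ} (ha : 0 < a) (θ : 𝓢(E, ℂ)) (y : E) :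
    (𝓕 (SchwartzMap.smulLeftCLM ℂ (fun ξ : E => (heatSymbol a ξ : ℂ)) (𝓕⁻ θ))) y =
      ∫ x, θ x * (heatKernel a (y - x) : ℂ) := by
  obtain ⟨Ψ, hΨ⟩ := UnboundedOperators.exists_schwartzMap_coe_eq_heatSymbol (E := E) ha
  have hF : ∀ z : E, (𝓕 Ψ) z = (heatKernel a z : ℂ) := fun z => by
    have h1 := FunctionSpaces.fourierInv_apply_eq_fourier_neg Ψ (-z)
    rw [neg_neg] at h1
    rw [← h1, UnboundedOperators.coe_fourierInv_eq_heatKernel_of_coe_eq_heatSymbol ha hΨ]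
    simp only [UnboundedOperators.heatKernel_neg]
  rw [← hΨ, FunctionSpaces.fourier_smulLeftCLM_fourierInv_apply_eq_integral Ψ θ y]
  exact integral_congr_ae (Eventually.of_forall fun x => by simp only [hF])

/-- **The heat transpose against bounded fields**: for a bounded measurable field
`f : E → ℝ^ι`, `a > 0` and a Schwartz `θ`, `∫ θ(x) • (e^{aΔ}f)(x) dx = ∫ (T_a θ)(y) • f(y) dy`
(complexified values; `e^{aΔ}f = G_a ∗ f` the caloric extension, `T_a θ = G_a ∗ θ`; Fubini on
`E × E` under `|θ(x)| G_a(x - y) M ∈ L¹`, and `G_a` even). This is the function-level form of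
`⟨e^{aΔ}W, θ⟩ = ⟨W, T_a θ⟩` for the distribution `W` of `f` (Lemarié-Rieusset 2016, §6.2,
Prop. 6.1: `W_{νt} ∗ u₀` for distribution data). [cite: LemarieRieusset2016, Prop. 6.1] -/
theorem integral_smul_complexify_heatExtension_eq {f : E → EuclideanSpace ℝ ι}
    (hf : AEStronglyMeasurable f volume) {M : ℝ} (hM : ∀ x, ‖f x‖ ≤ M) {a : ℝ} (ha : 0 < a)
    (θ : 𝓢(E, ℂ)) :
    ∫ x, θ x • complexify (heatExtension f a x) =
      ∫ y, (𝓕 (SchwartzMap.smulLeftCLM ℂ (fun ξ : E => (heatSymbol a ξ : ℂ)) (𝓕⁻ θ))) y •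
        complexify (f y) := by
  have hG := UnboundedOperators.integrable_heatKernel_holds (E := E) ha
  have hGpos : ∀ z : E, 0 ≤ heatKernel a z := fun z => (UnboundedOperators.heatKernel_pos ha z).le
  have hcf : AEStronglyMeasurable (fun y => complexify (f y)) volume :=
    FunctionSpaces.EuclideanSpace.continuous_complexify.comp_aestronglyMeasurable hf
  -- the integrand on `E × E`
  set H : E → E → EuclideanSpace ℂ ι := fun x y => (θ x * (heatKernel a (x - y) : ℂ)) • complexify (f y)
    with hH
  have hHnorm : ∀ x y, ‖H x y‖ ≤ ‖θ x‖ * (heatKernel a (x - y) * M) := fun x y => by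
    simp only [hH, norm_smul, norm_mul, Complex.norm_real, FunctionSpaces.EuclideanSpace.norm_complexify,
      Real.norm_of_nonneg (hGpos _)]
    rw [mul_assoc]
    exact mul_le_mul_of_nonneg_left (mul_le_mul_of_nonneg_left (hM y) (hGpos _)) (norm_nonneg _)
  have hGc : Continuous (heatKernel (E := E) a) := UnboundedOperators.continuous_heatKernel a
  have hHm : AEStronglyMeasurable (uncurry H) ((volume : Measure E).prod volume) := by
    have h1 : Continuous fun z : E × E => θ z.1 * (heatKernel a (z.1 - z.2) : ℂ) :=
      (θ.continuous.comp continuous_fst).mul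
        (Complex.continuous_ofReal.comp (hGc.comp (continuous_fst.sub continuous_snd)))
    exact h1.aestronglyMeasurable.smul hcf.comp_snd
  have hslice_m : ∀ x, AEStronglyMeasurable (fun y => H x y) volume := fun x => by
    have h1 : Continuous fun y : E => θ x * (heatKernel a (x - y) : ℂ) :=
      continuous_const.mul (Complex.continuous_ofReal.comp (hGc.comp (continuous_const.sub continuous_id)))
    exact h1.aestronglyMeasurable.smul hcf
  have hslice_i : ∀ x, Integrable (fun y => H x y) := fun x =>
    ((((hG.comp_sub_left x).mul_const M).const_mul ‖θ x‖)).mono' (hslice_m x)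
      (Eventually.of_forall fun y => hHnorm x y)
  have hHint : Integrable (uncurry H) ((volume : Measure E).prod volume) := by
    rw [integrable_prod_iff hHm]
    refine ⟨Eventually.of_forall fun x => hslice_i x, ?_⟩
    refine ((θ.integrable.norm).mul_const M).mono' hHm.norm.integral_prod_right'
      (Eventually.of_forall fun x => ?_)
    rw [Real.norm_of_nonneg (integral_nonneg fun y => norm_nonneg _)]
    calc ∫ y, ‖uncurry H (x, y)‖ ≤ ∫ y, ‖θ x‖ * (heatKernel a (x - y) * M) :=
          integral_mono_of_nonneg (Eventually.of_forall fun _ => norm_nonneg _)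
            (((hG.comp_sub_left x).mul_const M).const_mul ‖θ x‖) (Eventually.of_forall fun y => hHnorm x y)
      _ = ‖θ x‖ * M := by
          rw [integral_const_mul, integral_mul_const,
            integral_sub_left_eq_self (fun y => heatKernel a y) volume x,
            UnboundedOperators.integral_heatKernel_eq_one_holds ha, one_mul]
  -- left-hand side: `θ x • complexify (∫ G(x-y) • f y) = ∫_y H x y`
  have hL : ∀ x, θ x • complexify (heatExtension f a x) = ∫ y, H x y := by
    intro x
    rw [UnboundedOperators.heatExtension_eq_integral_sub, ← (complexify (ι := ι)).integral_comp_comm,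
      ← integral_smul]
    refine integral_congr_ae (Eventually.of_forall fun y => ?_)
    simp only [hH, LinearIsometry.map_smul, mul_smul, Complex.coe_smul]
  -- right-hand side: `(T_a θ) y • complexify (f y) = ∫_x H x y`
  have hR : ∀ y, (𝓕 (SchwartzMap.smulLeftCLM ℂ (fun ξ : E => (heatSymbol a ξ : ℂ)) (𝓕⁻ θ))) y •
      complexify (f y) = ∫ x, H x y := by
    intro y
    rw [fourier_smulLeftCLM_heatSymbol_fourierInv_apply ha θ y, ← integral_smul_const]
    refine integral_congr_ae (Eventually.of_forall fun x => ?_)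
    simp only [hH, ← UnboundedOperators.heatKernel_neg a (x - y), neg_sub]
  simp_rw [hL, hR]
  exact integral_integral_swap hHint

/-- Pairings of an a.e. bounded measurable field with Schwartz functions are integrable
(complexified values). [folklore] -/
theorem integrable_schwartz_smul_complexify {f : E → EuclideanSpace ℝ ι} (hf : AEStronglyMeasurable f volume)
    {M : ℝ} (hM : ∀ᵐ x ∂(volume : Measure E), ‖f x‖ ≤ M) (ψ : 𝓢(E, ℂ)) :
    Integrable fun x => ψ x • complexify (f x) := by
  refine ((ψ.integrable.norm).mul_const M).mono'
    (ψ.continuous.aestronglyMeasurable.smul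
      (FunctionSpaces.EuclideanSpace.continuous_complexify.comp_aestronglyMeasurable hf)) ?_
  filter_upwards [hM] with x hx
  rw [norm_smul, FunctionSpaces.EuclideanSpace.norm_complexify]
  exact mul_le_mul_of_nonneg_left hx (norm_nonneg _)

end Transpose

/-! ## Representatives: the two sides only see a.e. classes -/

section Representatives

variable {E : Type*} [NormedAddCommGroup E] [InnerProductSpace ℝ E] [FiniteDimensional ℝ E]
  [MeasurableSpace E] [BorelSpace E]

/-- **The Duhamel term only sees the space–time a.e. class**: if `w τ = u τ` a.e. for a.e.
`τ ∈ (s, t)` then `B^ν_s(w,w)(t) = B^ν_s(u,u)(t)` everywhere (both inner integrals agree for a.e.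
`τ`). [folklore] -/
theorem oseenDuhamel_congr_ae_slices {ν s t : ℝ} {u w : ℝ → E → E}
    (hae : ∀ᵐ τ ∂((volume : Measure ℝ).restrict (Ioo s t)), w τ =ᵐ[volume] u τ) (x : E) :
    oseenDuhamel ν s w w t x = oseenDuhamel ν s u u t x := by
  unfold oseenDuhamel
  refine integral_congr_ae ?_
  filter_upwards [hae] with τ hτ
  exact integral_congr_ae (hτ.mono fun y hy => by simp only [hy])

/-- From a.e. equality on a space–time slab to a.e. equality of a.e. slices (Fubini). [folklore] -/
theorem ae_restrict_ae_eq_slice_of_ae_eq_uncurry {T : ℝ} {u g : ℝ → E → E}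
    (h : uncurry g =ᵐ[(volume : Measure (ℝ × E)).restrict (Ioo 0 T ×ˢ univ)] uncurry u) :
    ∀ᵐ τ ∂((volume : Measure ℝ).restrict (Ioo 0 T)), g τ =ᵐ[volume] u τ := by
  rw [volume_restrict_prod_univ_eq_prod] at h
  have h2 := Measure.ae_ae_of_ae_prod (p := fun z : ℝ × E => uncurry g z = uncurry u z) h
  filter_upwards [h2] with τ hτ
  filter_upwards [hτ] with y hy
  exact hy

/-- **A bounded, jointly strongly measurable representative.** If `u` is a.e.-strongly measurable
on the slab `(0, T) × E` and `‖u τ‖ ≤ M` a.e. for every `τ ∈ (0, T)` (`0 < M`), then some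
everywhere-defined field `w`, strongly measurable on `ℝ × E` and bounded by `M` everywhere,
agrees with `u` a.e. on a.e. slice: `w τ = u τ` a.e. for a.e. `τ ∈ (0, T)` (the radial retraction
of a strongly measurable modification). [folklore] -/
theorem exists_stronglyMeasurable_representative {T M : ℝ} {u : ℝ → E → E} (hM : 0 < M)
    (hmeas : AEStronglyMeasurable (uncurry u) ((volume : Measure (ℝ × E)).restrict (Ioo 0 T ×ˢ univ)))
    (hbd : ∀ τ ∈ Ioo 0 T, ∀ᵐ y ∂(volume : Measure E), ‖u τ y‖ ≤ M) :
    ∃ w : ℝ → E → E, StronglyMeasurable (uncurry w) ∧ (∀ τ y, ‖w τ y‖ ≤ M) ∧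
      ∀ᵐ τ ∂((volume : Measure ℝ).restrict (Ioo 0 T)), w τ =ᵐ[volume] u τ := by
  set G : ℝ → E → E := curry (hmeas.mk (uncurry u)) with hG
  have hGm : StronglyMeasurable (uncurry G) := by rw [hG, uncurry_curry]; exact hmeas.stronglyMeasurable_mk
  have hGu : uncurry G =ᵐ[(volume : Measure (ℝ × E)).restrict (Ioo 0 T ×ˢ univ)] uncurry u := by
    rw [hG, uncurry_curry]; exact hmeas.ae_eq_mk.symm
  have hGslice := ae_restrict_ae_eq_slice_of_ae_eq_uncurry hGu
  set ρ : E → E := fun v => (M / max M ‖v‖) • v with hρ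
  have hρc : Continuous ρ := continuous_radialRetract hM
  refine ⟨fun τ y => ρ (G τ y), hρc.comp_stronglyMeasurable hGm, fun τ y => norm_radialRetract_le hM _, ?_⟩
  have hmem : ∀ᵐ τ ∂((volume : Measure ℝ).restrict (Ioo 0 T)), τ ∈ Ioo 0 T := ae_restrict_mem measurableSet_Ioo
  filter_upwards [hGslice, hmem] with τ hτ hτmem
  filter_upwards [hτ, hbd τ hτmem] with y hy hyM
  simp only [hy, hρ]
  exact radialRetract_eq_self hM hyM

/-- **A bounded strongly measurable representative of an a.e. bounded slice** (retraction of a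
strongly measurable modification). [folklore] -/
theorem exists_stronglyMeasurable_representative_slice {M : ℝ} {f : E → E} (hM : 0 < M)
    (hf : AEStronglyMeasurable f volume) (hbd : ∀ᵐ y ∂(volume : Measure E), ‖f y‖ ≤ M) :
    ∃ g : E → E, StronglyMeasurable g ∧ (∀ y, ‖g y‖ ≤ M) ∧ g =ᵐ[volume] f := by
  set ρ : E → E := fun v => (M / max M ‖v‖) • v with hρ
  have hρc : Continuous ρ := continuous_radialRetract hM
  refine ⟨fun y => ρ (hf.mk f y), hρc.comp_stronglyMeasurable hf.stronglyMeasurable_mk,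
    fun y => norm_radialRetract_le hM _, ?_⟩
  filter_upwards [hf.ae_eq_mk, hbd] with y hy hyM
  simp only [← hy, hρ]
  exact radialRetract_eq_self hM hyM

end Representatives

/-! ## The discharge of (A) -/

section Assembly

/-- **Discharge of (A) `oseenMild_of_bounded_isBesovMildSolutionOn`: bounded Besov mild solutions
solve the Oseen integral equation** (Lemarié-Rieusset 2016, Thm. 6.1, (6.11) ⇒ (6.12), with
Lemma 6.4 (B) and Prop. 6.5 — very weak solutions vanishing at infinity are Oseen solutions; the
vanishing at infinity is the realisation clause of `MemHomBesov`, BCD Def. 1.26, through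
`tendsto_heatSemigroup_apply_atTop_of_memHomBesov`; KNSS 2009, §4 (i) with Lemma 3.1 / Rem. 3.1).
By (A1) (`exists_const_oseenMild_of_bounded_isBesovMildSolutionOn`) there is a constant `c` with
`u(t) = e^{νtΔ}u(0) - B^ν_0(u,u)(t) - c` a.e. Testing `e^{νtΔ}u(0) - B^ν_0(u,u)(t) - u(t) = c`
against `T_τ θ`, `θ` the Gaussian (both sides computed on bounded strongly measurable
representatives of `u(0)`, `u(t)` and of `u` on `(0, t) × (EuclideanSpace ℝ (Fin 3))`, which change neither term), gives
`(∫ θ) c = ⟨e^{(τ+νt)Δ}U(0), θ⟩ - ∫ θ • e^{τΔ}B^ν_0(u,u)(t) - ⟨e^{τΔ}U(t), θ⟩` for every `τ > 0`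
(`integral_smul_complexify_heatExtension_eq`, `heatSemigroup_add`); the three terms tend to `0` as
`τ → ∞` (`tendsto_heatSemigroup_apply_atTop_of_memHomBesov` at the times `0` and `t`,
`exists_norm_heatExtension_oseenDuhamel_le`), so `c = 0`. [cite: LemarieRieusset2016, Thm. 6.1 with Prop. 6.5 and Lemma 6.4 (B) (pp. 133–136)] -/
theorem oseenMild_of_bounded_isBesovMildSolutionOn_holds : oseenMild_of_bounded_isBesovMildSolutionOn := by
  intro ν T hν hT p q _ hp₃ hp hq₁ hq u U hB hbd t ht
  haveI : CompleteSpace (EuclideanSpace ℝ (Fin 3)) := FiniteDimensional.complete ℝ (EuclideanSpace ℝ (Fin 3))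
  -- (A1): the identity up to a constant
  obtain ⟨c, hc⟩ := exists_const_oseenMild_of_bounded_isBesovMildSolutionOn hν hT hp₃ hp hq₁ hq hB hbd ht
  -- exponents
  obtain ⟨hs2, hs0⟩ := gkp_index_mem_Ioo hp₃ hp
  have hq0 : q ≠ 0 := (lt_of_lt_of_le one_pos hq₁).ne'
  have hνt : 0 < ν * t := mul_pos hν ht.1
  -- the slab `[0, T₁)` and the essential bound
  set T₁ : ℝ := (t + T) / 2 with hT₁
  have htT₁ : t < T₁ := by rw [hT₁]; linarith [ht.2]
  have hT₁T : T₁ < T := by rw [hT₁]; linarith [ht.2]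
  have hT₁0 : 0 < T₁ := ht.1.trans htT₁
  obtain ⟨C, hCtop, hCb⟩ := hbd T₁ ⟨hT₁0, hT₁T⟩
  have hC0 : eLpNorm (u 0) ∞ volume ≤ C :=
    eLpNorm_top_zero_le_of_continuousInHomBesovOn hs0 (by linarith) hq₁ hT₁0 hT₁T.le
      hB.continuousInHomBesovOn hB.isDistributionOf hCtop hCb
  set M : ℝ := C.toReal + 1 with hMdef
  have hM : 0 < M := by positivity
  have hCM : C ≤ ENNReal.ofReal M := by
    calc C = ENNReal.ofReal C.toReal := (ENNReal.ofReal_toReal hCtop.ne).symm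
      _ ≤ ENNReal.ofReal (C.toReal + 1) := ENNReal.ofReal_le_ofReal (by linarith)
  have hbdM : ∀ τ ∈ Ico 0 T₁, ∀ᵐ y ∂(volume : Measure (EuclideanSpace ℝ (Fin 3))), ‖u τ y‖ ≤ M := by
    intro τ hτ
    have hle : eLpNorm (u τ) ∞ volume ≤ ENNReal.ofReal M := by
      rcases hτ.1.eq_or_lt with h0 | hpos
      · rw [← h0]; exact hC0.trans hCM
      · exact (hCb τ ⟨hpos, hτ.2⟩).trans hCM
    have hae : ∀ᵐ y ∂(volume : Measure (EuclideanSpace ℝ (Fin 3))), ‖u τ y‖ₑ ≤ ENNReal.ofReal M :=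
      (ae_le_eLpNormEssSup (f := u τ)).mono fun y hy => hy.trans (by rw [← eLpNorm_exponent_top]; exact hle)
    filter_upwards [hae] with y hy
    rw [← ofReal_norm] at hy
    exact (ENNReal.ofReal_le_ofReal_iff hM.le).1 hy
  -- the distributions at `0` and `t`
  have hdist0 : IsDistributionOf (u 0) (U 0) := hB.isDistributionOf 0 ⟨le_rfl, hT⟩
  have hdistt : IsDistributionOf (u t) (U t) := hB.isDistributionOf t ⟨ht.1.le, ht.2⟩
  have h0m : AEStronglyMeasurable (u 0) volume := hdist0.aestronglyMeasurable
  have htm : AEStronglyMeasurable (u t) volume := hdistt.aestronglyMeasurable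
  have hpair : ∀ {f : (EuclideanSpace ℝ (Fin 3)) → (EuclideanSpace ℝ (Fin 3))} {V : 𝓢'((EuclideanSpace ℝ (Fin 3)), (EuclideanSpace ℂ (Fin 3)))} {f' : (EuclideanSpace ℝ (Fin 3)) → (EuclideanSpace ℝ (Fin 3))}, IsDistributionOf f V → f' =ᵐ[volume] f →
      ∀ ψ : 𝓢((EuclideanSpace ℝ (Fin 3)), ℂ), ∫ y, ψ y • complexify (f' y) = V ψ := by
    intro f V f' hfV hff' ψ
    rw [(hfV ψ).2]
    exact integral_congr_ae (hff'.mono fun y hy => by simp only [hy])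
  -- bounded strongly measurable representatives of `u 0` and of `u` on `(0, t) × (EuclideanSpace ℝ (Fin 3))`
  obtain ⟨a₀, ha₀m, ha₀b, ha₀u⟩ := exists_stronglyMeasurable_representative_slice hM h0m (hbdM 0 ⟨le_rfl, hT₁0⟩)
  have hjm : AEStronglyMeasurable (uncurry u) ((volume : Measure (ℝ × (EuclideanSpace ℝ (Fin 3)))).restrict (Ioo 0 t ×ˢ univ)) :=
    hB.aestronglyMeasurable.mono_measure
      (Measure.restrict_mono (prod_mono (Ioo_subset_Ioo_right ht.2.le) Subset.rfl) le_rfl)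
  obtain ⟨w, hwm, hwb, hwu⟩ := exists_stronglyMeasurable_representative hM hjm
    (fun τ hτ => hbdM τ ⟨hτ.1.le, hτ.2.trans htT₁⟩)
  -- the three pieces `S = e^{νtΔ}u(0)`, `B = B^ν_0(u,u)(t)`, `u t`
  set S : (EuclideanSpace ℝ (Fin 3)) → (EuclideanSpace ℝ (Fin 3)) := fun x => heatExtension (u 0) (ν * t) x with hS
  set B : (EuclideanSpace ℝ (Fin 3)) → (EuclideanSpace ℝ (Fin 3)) := oseenDuhamel ν 0 u u t with hB'
  have hS_eq : ∀ x, S x = heatExtension a₀ (ν * t) x := fun x => by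
    rw [hS, heatExtension_congr_ae ha₀u.symm]
  have hB_eq : ∀ x, B x = oseenDuhamel ν 0 w w t x := fun x => (oseenDuhamel_congr_ae_slices hwu x).symm
  have hBfun : B = oseenDuhamel ν 0 w w t := funext hB_eq
  have hS_b : ∀ x, ‖S x‖ ≤ M := fun x => by
    rw [hS_eq]; exact UnboundedOperators.norm_heatExtension_le ha₀b hνt x
  have hS_m : AEStronglyMeasurable S volume := by
    have hsm : ContDiff ℝ ((⊤ : ℕ∞) : WithTop ℕ∞) (heatExtension a₀ (ν * t)) :=
      UnboundedOperators.contDiff_heatExtension_holds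
        (memLp_top_of_bound ha₀m.aestronglyMeasurable M (Eventually.of_forall ha₀b)) le_top hνt
    have heq : S = heatExtension a₀ (ν * t) := funext hS_eq
    rw [heq]
    exact hsm.continuous.aestronglyMeasurable
  have hwslab : AEStronglyMeasurable (uncurry w) ((volume : Measure (ℝ × (EuclideanSpace ℝ (Fin 3)))).restrict (Ioo 0 t ×ˢ univ)) :=
    hwm.aestronglyMeasurable
  have hwb' : ∀ τ ∈ Ioo 0 t, ∀ y, ‖w τ y‖ ≤ M := fun τ _ y => hwb τ y
  obtain ⟨CB, -, hCBle⟩ := exists_norm_oseenDuhamel_bounded_le (E := (EuclideanSpace ℝ (Fin 3)))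
  have hB_b : ∀ x, ‖B x‖ ≤ CB * M ^ 2 * ν ^ (-(1 / 2 : ℝ)) * (2 * Real.sqrt (t - 0)) := fun x => by
    rw [hB_eq]
    exact hCBle hν ht.1 hM.le (fun τ _ y => hwb τ y) (fun τ _ y => hwb τ y) x
  have hB_m : AEStronglyMeasurable B volume := by
    rw [hBfun]
    exact aestronglyMeasurable_oseenDuhamel hν hwslab hwslab hM.le hwb' hwb' ht.1 le_rfl
  obtain ⟨CD, hCD⟩ := exists_norm_heatExtension_oseenDuhamel_le hwm hM.le hwb hν ht.1
  have hut_b : ∀ᵐ y ∂(volume : Measure (EuclideanSpace ℝ (Fin 3))), ‖u t y‖ ≤ M := hbdM t ⟨ht.1.le, htT₁⟩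
  -- `S - B - u t = c` a.e.
  have hconst : (fun x => S x - B x - u t x) =ᵐ[volume] fun _ => c := by
    filter_upwards [hc] with x hx
    simp only [hS, hB'] at hx ⊢
    rw [hx]
    abel
  -- the Gaussian test function
  set θ : 𝓢((EuclideanSpace ℝ (Fin 3)), ℂ) := FunctionSpaces.heatKernelSchwartz (EuclideanSpace ℝ (Fin 3)) 1 with hθdef
  have hθint : ∫ x, θ x = 1 := by
    have h1 : ∫ x, θ x = ((∫ x : (EuclideanSpace ℝ (Fin 3)), heatKernel 1 x : ℝ) : ℂ) := by
      rw [← integral_complex_ofReal]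
      exact integral_congr_ae (Eventually.of_forall fun x => FunctionSpaces.heatKernelSchwartz_apply one_pos x)
    rw [h1, UnboundedOperators.integral_heatKernel_eq_one_holds one_pos]
    simp
  -- the pairings with `T_τ θ`, `τ > 0`
  have hkey : ∀ τ : ℝ, 0 < τ → complexify c =
      TemperedDistribution.heatSemigroup (τ + ν * t) (U 0) θ -
        (∫ x, θ x • complexify (heatExtension B τ x)) -
        TemperedDistribution.heatSemigroup τ (U t) θ := by
    intro τ hτ
    set ψ : 𝓢((EuclideanSpace ℝ (Fin 3)), ℂ) := 𝓕 (SchwartzMap.smulLeftCLM ℂ (fun ξ : (EuclideanSpace ℝ (Fin 3)) => (heatSymbol τ ξ : ℂ)) (𝓕⁻ θ)) with hψ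
    -- `∫ ψ • (S - B - u t) = (∫ θ) • c = c`
    have e0 : ∫ x, ψ x • complexify (S x - B x - u t x) = complexify c := by
      have h1 : ∫ x, ψ x • complexify (S x - B x - u t x) = ∫ x, ψ x • complexify ((fun _ : (EuclideanSpace ℝ (Fin 3)) => c) x) :=
        integral_congr_ae (hconst.mono fun x hx => by simp only [hx])
      have h2 := integral_smul_complexify_heatExtension_eq (f := fun _ : (EuclideanSpace ℝ (Fin 3)) => c)
        aestronglyMeasurable_const (M := ‖c‖) (fun _ => le_rfl) hτ θ
      rw [h1, ← h2]
      have h3 : ∀ x : (EuclideanSpace ℝ (Fin 3)), heatExtension (fun _ : (EuclideanSpace ℝ (Fin 3)) => c) τ x = c := fun x =>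
        UnboundedOperators.heatExtension_const c hτ x
      simp_rw [h3, integral_smul_const, hθint, one_smul]
    -- the three pairings
    have e1 : ∫ x, ψ x • complexify (S x) = TemperedDistribution.heatSemigroup (τ + ν * t) (U 0) θ := by
      have h1 : ∫ x, ψ x • complexify (S x) = ∫ x, ψ x • complexify (heatExtension a₀ (ν * t) x) :=
        integral_congr_ae (Eventually.of_forall fun x => by simp only [hS_eq])
      rw [h1, integral_smul_complexify_heatExtension_eq ha₀m.aestronglyMeasurable ha₀b hνt ψ,
        hpair hdist0 ha₀u _,
        TemperedDistribution.heatSemigroup_add UnboundedOperators.heatSymbol_hasTemperateGrowth_holds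
          hτ.le hνt.le]
      rfl
    have e2 : ∫ x, ψ x • complexify (B x) = ∫ x, θ x • complexify (heatExtension B τ x) :=
      (integral_smul_complexify_heatExtension_eq hB_m hB_b hτ θ).symm
    have e3 : ∫ x, ψ x • complexify (u t x) = TemperedDistribution.heatSemigroup τ (U t) θ := by
      rw [hpair hdistt (ae_eq_refl _) ψ]
      rfl
    -- split the integral
    have i1 := integrable_schwartz_smul_complexify hS_m (Eventually.of_forall hS_b) ψ
    have i2 := integrable_schwartz_smul_complexify hB_m (Eventually.of_forall hB_b) ψ
    have i3 := integrable_schwartz_smul_complexify htm hut_b ψ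
    have i12 : Integrable (fun x => ψ x • complexify (S x) - ψ x • complexify (B x)) := i1.sub i2
    have esplit : ∫ x, ψ x • complexify (S x - B x - u t x) =
        (∫ x, ψ x • complexify (S x)) - (∫ x, ψ x • complexify (B x)) - ∫ x, ψ x • complexify (u t x) := by
      rw [← integral_sub i1 i2, ← integral_sub i12 i3]
      refine integral_congr_ae (Eventually.of_forall fun x => ?_)
      simp only [map_sub, smul_sub]
    rw [← e0, esplit, e1, e2, e3]
  -- the three terms tend to zero
  have hlim1 : Tendsto (fun τ : ℝ => TemperedDistribution.heatSemigroup (τ + ν * t) (U 0) θ) atTop (𝓝 0) :=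
    (tendsto_heatSemigroup_apply_atTop_of_memHomBesov hs0 hq0 (hB.continuousInHomBesovOn.1 0 ⟨le_rfl, hT⟩) θ).comp
      (tendsto_atTop_add_const_right atTop (ν * t) tendsto_id)
  have hlim2 : Tendsto (fun τ : ℝ => ∫ x, θ x • complexify (heatExtension B τ x)) atTop (𝓝 0) := by
    have hlim : Tendsto (fun τ : ℝ => (∫ x, ‖θ x‖) * (CD * τ ^ (-(1 / 2 : ℝ)))) atTop (𝓝 0) := by
      have h0 := (tendsto_rpow_neg_atTop (y := (1 / 2 : ℝ)) (by norm_num)).const_mul CD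
      rw [mul_zero] at h0
      have := h0.const_mul (∫ x, ‖θ x‖)
      rwa [mul_zero] at this
    refine squeeze_zero_norm' ?_ hlim
    filter_upwards [eventually_gt_atTop 0] with τ hτ
    calc ‖∫ x, θ x • complexify (heatExtension B τ x)‖ ≤ ∫ x, ‖θ x • complexify (heatExtension B τ x)‖ :=
          norm_integral_le_integral_norm _
      _ ≤ ∫ x, ‖θ x‖ * (CD * τ ^ (-(1 / 2 : ℝ))) := by
          refine integral_mono_of_nonneg (Eventually.of_forall fun _ => norm_nonneg _)
            (θ.integrable.norm.mul_const _) (Eventually.of_forall fun x => ?_)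
          dsimp only
          rw [norm_smul, FunctionSpaces.EuclideanSpace.norm_complexify, hBfun]
          exact mul_le_mul_of_nonneg_left (hCD hτ x) (norm_nonneg _)
      _ = (∫ x, ‖θ x‖) * (CD * τ ^ (-(1 / 2 : ℝ))) := integral_mul_const _ _
  have hlim3 : Tendsto (fun τ : ℝ => TemperedDistribution.heatSemigroup τ (U t) θ) atTop (𝓝 0) :=
    tendsto_heatSemigroup_apply_atTop_of_memHomBesov hs0 hq0 (hB.continuousInHomBesovOn.1 t ⟨ht.1.le, ht.2⟩) θ
  have hc0 : c = 0 := by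
    have hsum := (hlim1.sub hlim2).sub hlim3
    rw [sub_zero, sub_zero] at hsum
    have hconstlim : Tendsto (fun τ : ℝ => TemperedDistribution.heatSemigroup (τ + ν * t) (U 0) θ -
        (∫ x, θ x • complexify (heatExtension B τ x)) - TemperedDistribution.heatSemigroup τ (U t) θ)
        atTop (𝓝 (complexify c)) :=
      tendsto_const_nhds.congr' (by
        filter_upwards [eventually_gt_atTop 0] with τ hτ
        exact hkey τ hτ)
    have h := tendsto_nhds_unique hconstlim hsum
    exact (map_eq_zero_iff complexify FunctionSpaces.EuclideanSpace.complexify_injective).1 h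
  -- conclude
  filter_upwards [hc] with x hx
  rw [hx, hc0, sub_zero]

end Assembly

end Literature.Analysis.FluidPDE

end
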